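import Summits.Ventures.LatticeQCDFlow.Exactness.ReversibleVariationalSupTauInt
import Summits.Ventures.LatticeQCDFlow.Exactness.ReversibleStickySet
import HarnessLib

/-!
# The POINCARÉ CEILING, dual of the floors: a spectral-gap inequality on the admissible class bounds the autocorrelation sum of EVERY observable, `Σ_k ρ(k) sᵏ ≤ 1/(1 − s(1 − γ))`, `τ_int ≤ 1/γ − ½`

HONEST FRAMING: exact (Metropolis-corrected) sampling algorithms for lattice gauge theory;
figures of merit are autocorrelation/cost numbers at stated couplings and volumes; no
continuum-physics claim.  (SCALAR calibration rung S0-A: not a gauge result.)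

Venture `LatticeQCDFlow` (cell pub-lqcd), topic `Exactness`; FANOUT row 2 (`s0-phi4`).  NEW WORK
of the cell over `Exactness/ReversibleVariationalSup.lean` / `ReversibleVariationalSupTauInt.lean`
(the Abel autocorrelation sum of a reversible exact sampler in the `RevOp` format is the LEAST
constant `B` with `(∫ g v w)² ≤ B · Q_r(v)` on the admissible class).  Only Cauchy–Schwarz and limits
of real sequences; no spectral theorem.  Nothing is cited as a fact.  Printed counterparts, NAMED
ONLY: the spectral-gap bound on the integrated autocorrelation time of a reversible chain
(`τ_int,f ≤ τ_exp`-type inequalities, Sokal 1989/1997 lectures; Madras–Slade 1993 §9.2.3), and the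
Poincaré-inequality route to variance bounds for reversible Markov chains (Kipnis–Varadhan 1986).
Every earlier `RevOp` file of the tree is a FLOOR (`τ_int ≥ …`); this is the matching CEILING in the
same vocabulary, so that a Poincaré inequality proved for any sampler of the tree — by minorisation,
by a weight bound (the flow arm: `Exactness/FlowSamplerSpectralGap.lean`, `τ_int ≤ W − ½`, already in
the tree by a direct route), or by comparison (`Exactness/ReversibleComparison.lean`) — converts at
once into a `τ_int` ceiling for every observable of the class.

## Setting

`RevOp` format with `1 ∈ A` and `K 1 = 1`; `Z = ∫ w`; an observable `g ∈ A` is CENTRED if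
`∫ g w = 0`; `C(k) = ∫ g (Kᵏ g) w`, `P = C(0)`; `𝓔(v) = ∫ v² w − ∫ v (K v) w`.  POINCARÉ INEQUALITY
on the class with constant `γ`: `γ ∫ u² w ≤ 𝓔(u)` for every CENTRED `u ∈ A` (equivalently, using
`K 1 = 1`, `γ · Var_w(v) ≤ 𝓔(v)` for every `v ∈ A`).

## What is proved (namespace `RevOp`)

* `dirichlet_sub_const`, `integral_sq_sub_const`, `inner_sub_const` — centring a trial observable
  (`sub_const_mem` is reused from `Exactness/ReversibleStickySet.lean`):
  `𝓔(v − m) = 𝓔(v)` (`K 1 = 1`), `∫ (v − m)² w = ∫ v² w − 2m ∫ v w + m² Z`, `∫ g (v − m) w = ∫ g v w`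
  for centred `g`;
* **`abelSum_le_of_poincare`** (unconditional): Poincaré with constant `γ ≥ 0`, `g ∈ A` centred,
  `0 ≤ s < 1`  ⇒  **`Σ_k C(k) sᵏ ≤ P / (1 − s(1 − γ))`**;  normalised (`P > 0`):
  `abelSum_autocorr_le_of_poincare` — `Σ_k ρ(k) sᵏ ≤ 1/(1 − s(1 − γ))` (`→ 1/γ` as `s ↑ 1`);
* **`tsum_le_of_poincare`**, **`tauInt_le_of_poincare`** — under the tree's standing summability
  hypothesis: `Σ_k C(k) ≤ P/γ`, i.e. **`τ_int(g) ≤ 1/γ − ½`** (`γ > 0`);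
* (companion `Exactness/ReversiblePoincareCeilingPositive.lean`: for a sampler with NONNEGATIVE
  autocovariances — a positive operator — bounded Abel sums force summability, so the ceiling needs
  no summability hypothesis at all.)

Reading: FLOOR and CEILING are the two sides of one formula — a carré-du-champ bound
`Γ_g ≤ D` gives `τ ≥ 2P/D − ½`, a Poincaré constant `γ` gives `τ ≤ 1/γ − ½`, and a sampler with
`𝓔(v) ≍ Var(v)` uniformly on the class has all its `τ_int` within those two numbers.  NOT CLAIMED:
a Poincaré inequality for any lattice sampler of the tree beyond those already proved (the HMC arm
has NO spectral gap at fixed step size: `Exactness/Phi4HMCNoSpectralGap*.lean`); a ceiling from a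
one-sided bound on a single observable (false in general); any number for any run.
-/

namespace Summit.Ventures.LatticeQCDFlow.Exactness

open Real MeasureTheory Filter Finset Topology
open Summit.Ventures.LatticeQCDFlow.Scoring

namespace RevOp

variable {X : Type*} [MeasurableSpace X] {μ : Measure X} {w : X → ℝ} {A : (X → ℝ) → Prop}
  {K : (X → ℝ) → (X → ℝ)}

/-! ## §1 Centring a trial observable -/

-- (`RevOp.sub_const_mem : A (fun x => v x - m)` is `Exactness/ReversibleStickySet.lean`.)

/-- `∫ (v − m)² w = ∫ v² w − 2 m ∫ v w + m² Z`. -/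
theorem integral_sq_sub_const (hA1 : A (fun _ => (1 : ℝ)))
    (hAi : ∀ ⦃f h : X → ℝ⦄, A f → A h → Integrable (fun x => f x * h x * w x) μ)
    {v : X → ℝ} (hv : A v) (m : ℝ) :
    ∫ x, (v x - m) ^ 2 * w x ∂μ
      = (∫ x, v x ^ 2 * w x ∂μ) - 2 * m * (∫ x, v x * w x ∂μ) + m ^ 2 * ∫ x, w x ∂μ := by
  have ivv := integrable_sq_mul hAi hv
  have iv1 : Integrable (fun x => v x * w x) μ :=
    (hAi hv hA1).congr (Eventually.of_forall fun x => by simp)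
  have i11 : Integrable (fun x => w x) μ :=
    (hAi hA1 hA1).congr (Eventually.of_forall fun x => by simp)
  have e : ∀ x, (v x - m) ^ 2 * w x
      = v x ^ 2 * w x - 2 * m * (v x * w x) + m ^ 2 * w x := fun x => by ring
  have i2 : Integrable (fun x => 2 * m * (v x * w x)) μ := iv1.const_mul _
  have i12 : Integrable (fun x => v x ^ 2 * w x - 2 * m * (v x * w x)) μ := ivv.sub i2
  have i3 : Integrable (fun x => m ^ 2 * w x) μ := i11.const_mul _
  simp_rw [e]
  rw [integral_add i12 i3, integral_sub ivv i2, integral_const_mul, integral_const_mul]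

/-- `∫ (v − m) K(v − m) w = ∫ v (K v) w − 2 m ∫ v w + m² Z` (`K 1 = 1`, symmetry, linearity). -/
theorem integral_sub_const_mul_op (hA1 : A (fun _ => (1 : ℝ)))
    (hAi : ∀ ⦃f h : X → ℝ⦄, A f → A h → Integrable (fun x => f x * h x * w x) μ)
    (hAK : ∀ ⦃f : X → ℝ⦄, A f → A (K f))
    (hlin : ∀ ⦃f h : X → ℝ⦄ (c : ℝ), A f → A h →
      ∀ x, K (fun s => f s + c * h s) x = K f x + c * K h x)
    (hsymm : ∀ ⦃f h : X → ℝ⦄, A f → A h →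
      ∫ x, K f x * h x * w x ∂μ = ∫ x, f x * K h x * w x ∂μ)
    (hunit : ∀ x, K (fun _ => (1 : ℝ)) x = 1)
    {v : X → ℝ} (hv : A v) (m : ℝ) :
    ∫ x, (v x - m) * K (fun y => v y - m) x * w x ∂μ
      = (∫ x, v x * K v x * w x ∂μ) - 2 * m * (∫ x, v x * w x ∂μ) + m ^ 2 * ∫ x, w x ∂μ := by
  have hKv := hAK hv
  have ivKv := hAi hv hKv
  have iv1 : Integrable (fun x => v x * w x) μ :=
    (hAi hv hA1).congr (Eventually.of_forall fun x => by simp)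
  have i11 : Integrable (fun x => w x) μ :=
    (hAi hA1 hA1).congr (Eventually.of_forall fun x => by simp)
  -- `K(v − m) = K v − m`
  have hK : ∀ x, K (fun y => v y - m) x = K v x - m := by
    intro x
    have h := hlin (-m) hv hA1 x
    have e : (fun s => v s + -m * (1 : ℝ)) = fun y => v y - m := funext fun s => by ring
    rw [e] at h
    rw [h, hunit x]
    ring
  -- `∫ (K v) w = ∫ v w` (symmetry against `1`, `K 1 = 1`)
  have hKv1 : ∫ x, K v x * w x ∂μ = ∫ x, v x * w x ∂μ := by
    have h := hsymm hv hA1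
    have e1 : ∫ x, K v x * (1 : ℝ) * w x ∂μ = ∫ x, K v x * w x ∂μ :=
      integral_congr_ae (Eventually.of_forall fun x => by ring)
    have e2 : ∫ x, v x * K (fun _ => (1 : ℝ)) x * w x ∂μ = ∫ x, v x * w x ∂μ :=
      integral_congr_ae (Eventually.of_forall fun x => by simp only [hunit x, mul_one])
    rw [← e1, h, e2]
  have iKv1 : Integrable (fun x => K v x * w x) μ :=
    (hAi hKv hA1).congr (Eventually.of_forall fun x => by simp)
  have e : ∀ x, (v x - m) * K (fun y => v y - m) x * w x
      = v x * K v x * w x - m * (v x * w x) - m * (K v x * w x) + m ^ 2 * w x := by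
    intro x; rw [hK x]; ring
  have i2 : Integrable (fun x => m * (v x * w x)) μ := iv1.const_mul _
  have i3 : Integrable (fun x => m * (K v x * w x)) μ := iKv1.const_mul _
  have i4 : Integrable (fun x => m ^ 2 * w x) μ := i11.const_mul _
  have i12 : Integrable (fun x => v x * K v x * w x - m * (v x * w x)) μ := ivKv.sub i2
  have i123 : Integrable (fun x => v x * K v x * w x - m * (v x * w x) - m * (K v x * w x)) μ :=
    i12.sub i3
  simp_rw [e]
  rw [integral_add i123 i4, integral_sub i12 i3, integral_sub ivKv i2, integral_const_mul,
    integral_const_mul, integral_const_mul, hKv1]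
  ring

/-- **Centring does not change the Dirichlet form**: `𝓔(v − m) = 𝓔(v)` (`1 ∈ A`, `K 1 = 1`). -/
theorem dirichlet_sub_const (hA1 : A (fun _ => (1 : ℝ)))
    (hAi : ∀ ⦃f h : X → ℝ⦄, A f → A h → Integrable (fun x => f x * h x * w x) μ)
    (hAK : ∀ ⦃f : X → ℝ⦄, A f → A (K f))
    (hlin : ∀ ⦃f h : X → ℝ⦄ (c : ℝ), A f → A h →
      ∀ x, K (fun s => f s + c * h s) x = K f x + c * K h x)
    (hsymm : ∀ ⦃f h : X → ℝ⦄, A f → A h →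
      ∫ x, K f x * h x * w x ∂μ = ∫ x, f x * K h x * w x ∂μ)
    (hunit : ∀ x, K (fun _ => (1 : ℝ)) x = 1)
    {v : X → ℝ} (hv : A v) (m : ℝ) :
    (∫ x, (v x - m) ^ 2 * w x ∂μ) - ∫ x, (v x - m) * K (fun y => v y - m) x * w x ∂μ
      = (∫ x, v x ^ 2 * w x ∂μ) - ∫ x, v x * K v x * w x ∂μ := by
  rw [integral_sq_sub_const hA1 hAi hv m, integral_sub_const_mul_op hA1 hAi hAK hlin hsymm hunit hv m]
  ring

/-- For a CENTRED `g` (`∫ g w = 0`): `∫ g (v − m) w = ∫ g v w`. -/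
theorem inner_sub_const (hA1 : A (fun _ => (1 : ℝ)))
    (hAi : ∀ ⦃f h : X → ℝ⦄, A f → A h → Integrable (fun x => f x * h x * w x) μ)
    {g v : X → ℝ} (hg : A g) (hv : A v) (hg0 : ∫ x, g x * w x ∂μ = 0) (m : ℝ) :
    ∫ x, g x * (v x - m) * w x ∂μ = ∫ x, g x * v x * w x ∂μ := by
  have igv := hAi hg hv
  have ig1 : Integrable (fun x => g x * w x) μ :=
    (hAi hg hA1).congr (Eventually.of_forall fun x => by simp)
  have e : ∀ x, g x * (v x - m) * w x = g x * v x * w x - m * (g x * w x) := fun x => by ring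
  simp_rw [e]
  rw [integral_sub igv (ig1.const_mul _), integral_const_mul, hg0, mul_zero, sub_zero]

/-- The centred trial observable: with `m = (∫ v w)/Z` (`Z = ∫ w > 0`), `u = v − m` has
`∫ u w = 0` and `∫ u² w = ∫ v² w − (∫ v w)²/Z ≤ ∫ v² w`. -/
theorem centred_trial (hA1 : A (fun _ => (1 : ℝ)))
    (hAi : ∀ ⦃f h : X → ℝ⦄, A f → A h → Integrable (fun x => f x * h x * w x) μ)
    {v : X → ℝ} (hv : A v) (hZ : 0 < ∫ x, w x ∂μ) :
    (∫ x, (v x - (∫ x, v x * w x ∂μ) / ∫ x, w x ∂μ) * w x ∂μ = 0) ∧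
    (∫ x, (v x - (∫ x, v x * w x ∂μ) / ∫ x, w x ∂μ) ^ 2 * w x ∂μ
      = (∫ x, v x ^ 2 * w x ∂μ) - (∫ x, v x * w x ∂μ) ^ 2 / ∫ x, w x ∂μ) ∧
    (∫ x, (v x - (∫ x, v x * w x ∂μ) / ∫ x, w x ∂μ) ^ 2 * w x ∂μ ≤ ∫ x, v x ^ 2 * w x ∂μ) := by
  set Z := ∫ x, w x ∂μ with hZdef
  set I := ∫ x, v x * w x ∂μ with hI
  have iv1 : Integrable (fun x => v x * w x) μ :=
    (hAi hv hA1).congr (Eventually.of_forall fun x => by simp)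
  have i11 : Integrable (fun x => w x) μ :=
    (hAi hA1 hA1).congr (Eventually.of_forall fun x => by simp)
  have h1 : ∫ x, (v x - I / Z) * w x ∂μ = 0 := by
    have e : ∀ x, (v x - I / Z) * w x = v x * w x - (I / Z) * w x := fun x => by ring
    simp_rw [e]
    rw [integral_sub iv1 (i11.const_mul _), integral_const_mul]
    rw [← hI, ← hZdef]
    field_simp
    ring
  have h2 : ∫ x, (v x - I / Z) ^ 2 * w x ∂μ = (∫ x, v x ^ 2 * w x ∂μ) - I ^ 2 / Z := by
    rw [integral_sq_sub_const hA1 hAi hv, ← hI, ← hZdef]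
    field_simp
    ring
  refine ⟨h1, h2, ?_⟩
  rw [h2]
  have : 0 ≤ I ^ 2 / Z := div_nonneg (sq_nonneg _) hZ.le
  linarith

/-! ## §2 The ceiling in Abel form -/

/-- **THE POINCARÉ CEILING, ABEL FORM (unconditional).**  `RevOp` format with `1 ∈ A`, `K 1 = 1`,
`Z = ∫ w > 0`; Poincaré inequality `γ ∫ u² w ≤ ∫ u² w − ∫ u (K u) w` for every centred `u ∈ A`,
`γ ≥ 0`.  Then every CENTRED `g ∈ A` satisfies, for `0 ≤ s < 1`:
`Σ_k C_g(k) sᵏ ≤ C_g(0) / (1 − s (1 − γ))`. -/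
theorem abelSum_le_of_poincare (hw0 : ∀ x, 0 ≤ w x) (hA1 : A (fun _ => (1 : ℝ)))
    (hAi : ∀ ⦃f h : X → ℝ⦄, A f → A h → Integrable (fun x => f x * h x * w x) μ)
    (hAc : ∀ ⦃f h : X → ℝ⦄ (c : ℝ), A f → A h → A (fun x => f x + c * h x))
    (hAK : ∀ ⦃f : X → ℝ⦄, A f → A (K f))
    (hlin : ∀ ⦃f h : X → ℝ⦄ (c : ℝ), A f → A h →
      ∀ x, K (fun s => f s + c * h s) x = K f x + c * K h x)
    (hsymm : ∀ ⦃f h : X → ℝ⦄, A f → A h →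
      ∫ x, K f x * h x * w x ∂μ = ∫ x, f x * K h x * w x ∂μ)
    (hcontr : ∀ ⦃f : X → ℝ⦄, A f → ∫ x, K f x ^ 2 * w x ∂μ ≤ ∫ x, f x ^ 2 * w x ∂μ)
    (hunit : ∀ x, K (fun _ => (1 : ℝ)) x = 1) (hZ : 0 < ∫ x, w x ∂μ)
    {γ : ℝ} (hγ : 0 ≤ γ)
    (hPoinc : ∀ ⦃u : X → ℝ⦄, A u → ∫ x, u x * w x ∂μ = 0 →
      γ * ∫ x, u x ^ 2 * w x ∂μ ≤ (∫ x, u x ^ 2 * w x ∂μ) - ∫ x, u x * K u x * w x ∂μ)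
    {g : X → ℝ} (hg : A g) (hg0 : ∫ x, g x * w x ∂μ = 0) {s : ℝ} (hs0 : 0 ≤ s) (hs1 : s < 1) :
    ∑' k, (∫ x, g x * (K^[k] g) x * w x ∂μ) * s ^ k
      ≤ (∫ x, g x ^ 2 * w x ∂μ) / (1 - s * (1 - γ)) := by
  set P := ∫ x, g x ^ 2 * w x ∂μ with hPdef
  have hP0 : 0 ≤ P := integral_nonneg fun x => mul_nonneg (sq_nonneg _) (hw0 x)
  have hden : 0 < 1 - s * (1 - γ) := by nlinarith [mul_nonneg hs0 hγ]
  refine abelSum_le_of_forall_sq_inner_le hw0 hAi hAc hAK hlin hsymm hcontr hg hs0 hs1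
    (div_nonneg hP0 hden.le) fun v hv => ?_
  -- centre the trial observable
  set m := (∫ x, v x * w x ∂μ) / ∫ x, w x ∂μ with hm
  have hu : A (fun x => v x - m) := sub_const_mem hA1 hAc hv m
  obtain ⟨hu0, -, hule⟩ := centred_trial hA1 hAi hv hZ
  have hinner : ∫ x, g x * v x * w x ∂μ = ∫ x, g x * (v x - m) * w x ∂μ :=
    (inner_sub_const hA1 hAi hg hv hg0 m).symm
  have hE : (∫ x, (v x - m) ^ 2 * w x ∂μ) - ∫ x, (v x - m) * K (fun y => v y - m) x * w x ∂μ
      = (∫ x, v x ^ 2 * w x ∂μ) - ∫ x, v x * K v x * w x ∂μ :=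
    dirichlet_sub_const hA1 hAi hAK hlin hsymm hunit hv m
  set U := ∫ x, (v x - m) ^ 2 * w x ∂μ with hU
  have hU0 : 0 ≤ U := integral_nonneg fun x => mul_nonneg (sq_nonneg _) (hw0 x)
  -- Cauchy–Schwarz against the centred observable
  have hCS : (∫ x, g x * (v x - m) * w x ∂μ) ^ 2 ≤ P * U := sq_integral_mul_le hw0 hAi hg hu
  -- Poincaré: `γ U ≤ 𝓔(v)`; and `U ≤ ∫ v² w`
  have hPo : γ * U ≤ (∫ x, v x ^ 2 * w x ∂μ) - ∫ x, v x * K v x * w x ∂μ := by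
    rw [← hE]; exact hPoinc hu hu0
  -- hence `(1 − s(1 − γ)) U ≤ Q_s(v)`
  have hQ : (1 - s * (1 - γ)) * U
      ≤ (∫ x, v x ^ 2 * w x ∂μ) - s * ∫ x, v x * K v x * w x ∂μ := by
    have e : (∫ x, v x ^ 2 * w x ∂μ) - s * ∫ x, v x * K v x * w x ∂μ
        = (1 - s) * (∫ x, v x ^ 2 * w x ∂μ)
          + s * ((∫ x, v x ^ 2 * w x ∂μ) - ∫ x, v x * K v x * w x ∂μ) := by ring
    rw [e]
    have h1 : (1 - s) * U ≤ (1 - s) * ∫ x, v x ^ 2 * w x ∂μ :=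
      mul_le_mul_of_nonneg_left hule (by linarith)
    have h2 : s * (γ * U) ≤ s * ((∫ x, v x ^ 2 * w x ∂μ) - ∫ x, v x * K v x * w x ∂μ) :=
      mul_le_mul_of_nonneg_left hPo hs0
    nlinarith
  rw [hinner]
  calc (∫ x, g x * (v x - m) * w x ∂μ) ^ 2 ≤ P * U := hCS
    _ = P / (1 - s * (1 - γ)) * ((1 - s * (1 - γ)) * U) := by field_simp
    _ ≤ P / (1 - s * (1 - γ)) * ((∫ x, v x ^ 2 * w x ∂μ) - s * ∫ x, v x * K v x * w x ∂μ) :=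
        mul_le_mul_of_nonneg_left hQ (div_nonneg hP0 hden.le)

/-- **Normalised Abel form**: `Σ_k ρ(k) sᵏ ≤ 1/(1 − s(1 − γ))` for every centred `g ∈ A` with
`C_g(0) > 0` (the right side tends to `1/γ` as `s ↑ 1`). -/
theorem abelSum_autocorr_le_of_poincare (hw0 : ∀ x, 0 ≤ w x) (hA1 : A (fun _ => (1 : ℝ)))
    (hAi : ∀ ⦃f h : X → ℝ⦄, A f → A h → Integrable (fun x => f x * h x * w x) μ)
    (hAc : ∀ ⦃f h : X → ℝ⦄ (c : ℝ), A f → A h → A (fun x => f x + c * h x))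
    (hAK : ∀ ⦃f : X → ℝ⦄, A f → A (K f))
    (hlin : ∀ ⦃f h : X → ℝ⦄ (c : ℝ), A f → A h →
      ∀ x, K (fun s => f s + c * h s) x = K f x + c * K h x)
    (hsymm : ∀ ⦃f h : X → ℝ⦄, A f → A h →
      ∫ x, K f x * h x * w x ∂μ = ∫ x, f x * K h x * w x ∂μ)
    (hcontr : ∀ ⦃f : X → ℝ⦄, A f → ∫ x, K f x ^ 2 * w x ∂μ ≤ ∫ x, f x ^ 2 * w x ∂μ)
    (hunit : ∀ x, K (fun _ => (1 : ℝ)) x = 1) (hZ : 0 < ∫ x, w x ∂μ)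
    {γ : ℝ} (hγ : 0 ≤ γ)
    (hPoinc : ∀ ⦃u : X → ℝ⦄, A u → ∫ x, u x * w x ∂μ = 0 →
      γ * ∫ x, u x ^ 2 * w x ∂μ ≤ (∫ x, u x ^ 2 * w x ∂μ) - ∫ x, u x * K u x * w x ∂μ)
    {g : X → ℝ} (hg : A g) (hg0 : ∫ x, g x * w x ∂μ = 0) (hP : 0 < ∫ x, g x ^ 2 * w x ∂μ)
    {s : ℝ} (hs0 : 0 ≤ s) (hs1 : s < 1) :
    ∑' k, (∫ x, g x * (K^[k] g) x * w x ∂μ) / (∫ x, g x ^ 2 * w x ∂μ) * s ^ k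
      ≤ 1 / (1 - s * (1 - γ)) := by
  have h := abelSum_le_of_poincare hw0 hA1 hAi hAc hAK hlin hsymm hcontr hunit hZ hγ hPoinc hg hg0
    hs0 hs1
  have hden : 0 < 1 - s * (1 - γ) := by nlinarith [mul_nonneg hs0 hγ]
  have e : ∑' k, (∫ x, g x * (K^[k] g) x * w x ∂μ) / (∫ x, g x ^ 2 * w x ∂μ) * s ^ k
      = (∑' k, (∫ x, g x * (K^[k] g) x * w x ∂μ) * s ^ k) / ∫ x, g x ^ 2 * w x ∂μ := by
    rw [← tsum_div_const]
    exact tsum_congr fun k => by ring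
  rw [e, div_le_iff₀ hP]
  calc ∑' k, (∫ x, g x * (K^[k] g) x * w x ∂μ) * s ^ k
      ≤ (∫ x, g x ^ 2 * w x ∂μ) / (1 - s * (1 - γ)) := h
    _ = 1 / (1 - s * (1 - γ)) * ∫ x, g x ^ 2 * w x ∂μ := by ring

/-! ## §3 The ceiling for `τ_int` -/

/-- **`Σ_k C_g(k) ≤ C_g(0)/γ`** for a centred `g ∈ A` whose autocovariance series is summable, under a
Poincaré inequality with constant `γ > 0` on the class. -/
theorem tsum_le_of_poincare (hw0 : ∀ x, 0 ≤ w x) (hA1 : A (fun _ => (1 : ℝ)))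
    (hAi : ∀ ⦃f h : X → ℝ⦄, A f → A h → Integrable (fun x => f x * h x * w x) μ)
    (hAc : ∀ ⦃f h : X → ℝ⦄ (c : ℝ), A f → A h → A (fun x => f x + c * h x))
    (hAK : ∀ ⦃f : X → ℝ⦄, A f → A (K f))
    (hlin : ∀ ⦃f h : X → ℝ⦄ (c : ℝ), A f → A h →
      ∀ x, K (fun s => f s + c * h s) x = K f x + c * K h x)
    (hsymm : ∀ ⦃f h : X → ℝ⦄, A f → A h →
      ∫ x, K f x * h x * w x ∂μ = ∫ x, f x * K h x * w x ∂μ)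
    (hunit : ∀ x, K (fun _ => (1 : ℝ)) x = 1) (hZ : 0 < ∫ x, w x ∂μ)
    {γ : ℝ} (hγ : 0 < γ)
    (hPoinc : ∀ ⦃u : X → ℝ⦄, A u → ∫ x, u x * w x ∂μ = 0 →
      γ * ∫ x, u x ^ 2 * w x ∂μ ≤ (∫ x, u x ^ 2 * w x ∂μ) - ∫ x, u x * K u x * w x ∂μ)
    {g : X → ℝ} (hg : A g) (hg0 : ∫ x, g x * w x ∂μ = 0)
    (hs : Summable fun k => ∫ x, g x * (K^[k] g) x * w x ∂μ) :
    ∑' k, ∫ x, g x * (K^[k] g) x * w x ∂μ ≤ (∫ x, g x ^ 2 * w x ∂μ) / γ := by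
  set P := ∫ x, g x ^ 2 * w x ∂μ with hPdef
  have hP0 : 0 ≤ P := integral_nonneg fun x => mul_nonneg (sq_nonneg _) (hw0 x)
  refine tsum_le_of_forall_sq_inner_le_dirichlet hAi hAc hAK hlin hsymm hg hs (div_nonneg hP0 hγ.le)
    fun v hv => ?_
  set m := (∫ x, v x * w x ∂μ) / ∫ x, w x ∂μ with hm
  have hu : A (fun x => v x - m) := sub_const_mem hA1 hAc hv m
  obtain ⟨hu0, -, -⟩ := centred_trial hA1 hAi hv hZ
  have hinner : ∫ x, g x * v x * w x ∂μ = ∫ x, g x * (v x - m) * w x ∂μ :=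
    (inner_sub_const hA1 hAi hg hv hg0 m).symm
  have hE : (∫ x, (v x - m) ^ 2 * w x ∂μ) - ∫ x, (v x - m) * K (fun y => v y - m) x * w x ∂μ
      = (∫ x, v x ^ 2 * w x ∂μ) - ∫ x, v x * K v x * w x ∂μ :=
    dirichlet_sub_const hA1 hAi hAK hlin hsymm hunit hv m
  set U := ∫ x, (v x - m) ^ 2 * w x ∂μ with hU
  have hCS : (∫ x, g x * (v x - m) * w x ∂μ) ^ 2 ≤ P * U := sq_integral_mul_le hw0 hAi hg hu
  have hPo : γ * U ≤ (∫ x, v x ^ 2 * w x ∂μ) - ∫ x, v x * K v x * w x ∂μ := by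
    rw [← hE]; exact hPoinc hu hu0
  rw [hinner]
  calc (∫ x, g x * (v x - m) * w x ∂μ) ^ 2 ≤ P * U := hCS
    _ = P / γ * (γ * U) := by field_simp
    _ ≤ P / γ * ((∫ x, v x ^ 2 * w x ∂μ) - ∫ x, v x * K v x * w x ∂μ) :=
        mul_le_mul_of_nonneg_left hPo (div_nonneg hP0 hγ.le)

/-- **THE POINCARÉ CEILING FOR `τ_int`.**  `RevOp` format with `1 ∈ A`, `K 1 = 1`, `Z > 0`;
Poincaré inequality with constant `γ > 0` on the centred observables of the class; `g ∈ A` centred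
with `C_g(0) > 0` and a summable normalised autocorrelation series.  Then **`τ_int(g) ≤ 1/γ − ½`**. -/
theorem tauInt_le_of_poincare (hw0 : ∀ x, 0 ≤ w x) (hA1 : A (fun _ => (1 : ℝ)))
    (hAi : ∀ ⦃f h : X → ℝ⦄, A f → A h → Integrable (fun x => f x * h x * w x) μ)
    (hAc : ∀ ⦃f h : X → ℝ⦄ (c : ℝ), A f → A h → A (fun x => f x + c * h x))
    (hAK : ∀ ⦃f : X → ℝ⦄, A f → A (K f))
    (hlin : ∀ ⦃f h : X → ℝ⦄ (c : ℝ), A f → A h →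
      ∀ x, K (fun s => f s + c * h s) x = K f x + c * K h x)
    (hsymm : ∀ ⦃f h : X → ℝ⦄, A f → A h →
      ∫ x, K f x * h x * w x ∂μ = ∫ x, f x * K h x * w x ∂μ)
    (hunit : ∀ x, K (fun _ => (1 : ℝ)) x = 1) (hZ : 0 < ∫ x, w x ∂μ)
    {γ : ℝ} (hγ : 0 < γ)
    (hPoinc : ∀ ⦃u : X → ℝ⦄, A u → ∫ x, u x * w x ∂μ = 0 →
      γ * ∫ x, u x ^ 2 * w x ∂μ ≤ (∫ x, u x ^ 2 * w x ∂μ) - ∫ x, u x * K u x * w x ∂μ)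
    {g : X → ℝ} (hg : A g) (hg0 : ∫ x, g x * w x ∂μ = 0) (hP : 0 < ∫ x, g x ^ 2 * w x ∂μ)
    (hs : Summable fun n => (∫ x, g x * (K^[n + 1] g) x * w x ∂μ) / ∫ x, g x ^ 2 * w x ∂μ) :
    tauInt (fun n => (∫ x, g x * (K^[n] g) x * w x ∂μ) / ∫ x, g x ^ 2 * w x ∂μ) ≤ 1 / γ - 1 / 2 := by
  set C : ℕ → ℝ := fun k => ∫ x, g x * (K^[k] g) x * w x ∂μ with hC
  set P := ∫ x, g x ^ 2 * w x ∂μ with hPdef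
  have hsρ : Summable fun k => C k / P := (summable_nat_add_iff 1).1 hs
  have hsC : Summable C := (hsρ.mul_left P).congr fun k => by field_simp
  have hmain := tsum_le_of_poincare hw0 hA1 hAi hAc hAK hlin hsymm hunit hZ hγ hPoinc hg hg0 hsC
  have hC0 : C 0 = P := by
    simp only [hC, hPdef, Function.iterate_zero, id_eq]
    exact integral_congr_ae (Eventually.of_forall fun x => by ring)
  have h1 : (∑' k, C k) / P = tauInt (fun n => C n / P) + 1 / 2 := by
    rw [← tsum_div_const, hsρ.tsum_eq_zero_add, hC0, div_self hP.ne']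
    simp only [tauInt]
    ring
  have h2 : (∑' k, C k) / P ≤ 1 / γ := by
    rw [div_le_iff₀ hP]
    calc ∑' k, C k ≤ P / γ := hmain
      _ = 1 / γ * P := by ring
  linarith

end RevOp

end Summit.Ventures.LatticeQCDFlow.Exactness
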